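import Summits.CriticalPhenomena.PercolationContinuityZ3.Theorems.Transplant.SkelSignChoiceRef
import Summits.CriticalPhenomena.PercolationContinuityZ3.Theorems.Transplant.SkelSign1Params2
import HarnessLib

/-!
# D″ node, OPTION C (DPRIME-SCOPE addendum N.8/N.10): THE MULTI-TYPE CHOICE FUNCTION `PlanarSkeletonSign.signChoiceAll : ChoiceFnAll` — the
# choice function of record `signChoice₂` (stmt-g9, p254780) with the binder `Φ.types = {t}` dropped (its values `Sgn₂.choiceAt κ Φ t p hC` never
# used it), and its well-formedness `wfHoldsFnAll_signChoiceAll`; so the multi-type node reads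
# `samePDropOfSkeletonSign_of_choiceFnAll signChoiceAll wfHoldsFnAll_signChoiceAll rootHoldsFnAll_… faceHoldsRFnAll_… reachHoldsRHFnAll_…`
# once the three residues are re-instantiated at `AtQAll` (their one-call proofs, family already over `StepI.index Φ.types`)

builds on p205010 (kernel theorem, internal audit signed; external expert review pending) — nothing in this file uses p205010.
Lane `prim-bschramm`, seat `prim-bschramm-p3` (gen 7; D″ design owner); helper file (`--supports stmt-CriticalPhenomena-4575`).
[cite: KozmaNitzan2024, §4 Theorem 6 (pp. 25–31); §1 p. 2 (approach 1)]
-/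

noncomputable section

open MeasureTheory
open scoped Classical

namespace Summit.CriticalPhenomena.PercolationContinuityZ3.Theorems.Transplant

namespace PlanarSkeletonSign

open Literature.Probability.Percolation Literature.Probability.LatticeModels SimpleGraph
open Literature.Barriers.CriticalPhenomena (HasExponentialGrowth)

/-- **The multi-type choice function**: the values of record `Sgn₂.choiceAt κ Φ t p hC` at every admissible centred `(G, Φ, t, p, hC)` of
subexponential growth, for a `PlanarSkeletonSign` with ANY finite set of base vertex types. [this work] -/
def signChoiceAll : ChoiceFnAll :=
  fun κ _ _ _ _ _ Φ _ t _ _ p _ _ hC => Sgn₂.choiceAt κ Φ t p hC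

/-- `signChoiceAll` unfolds to `Sgn₂.choiceAt` (by `rfl`) — the same data as `signChoice₂`. [folklore] -/
theorem signChoiceAll_eq (κ : SkelConc.Consts) {V : Type} [DecidableEq V] [Countable V] (G : SimpleGraph V) [G.LocallyFinite]
    (Φ : PlanarSkeletonSign G) (hg : ¬ HasExponentialGrowth G) (t : V) (ht : t ∈ Φ.types) (h0 : Φ.φ t = 0) (p : unitInterval)
    (hp0 : 0 < (p : ℝ)) (hp1 : (p : ℝ) < 1) (hC : Φ.CylSubcritical p) :
    signChoiceAll κ G Φ hg t ht h0 p hp0 hp1 hC = Sgn₂.choiceAt κ Φ t p hC := rfl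

/-- On a one-type skeleton the multi-type choice function IS the choice function of record. [folklore] -/
theorem signChoiceAll_eq_signChoice₂ (κ : SkelConc.Consts) {V : Type} [DecidableEq V] [Countable V] (G : SimpleGraph V) [G.LocallyFinite]
    (Φ : PlanarSkeletonSign G) (hg : ¬ HasExponentialGrowth G) (t : V) (ht : t ∈ Φ.types) (h1 : Φ.types = {t}) (h0 : Φ.φ t = 0)
    (p : unitInterval) (hp0 : 0 < (p : ℝ)) (hp1 : (p : ℝ) < 1) (hC : Φ.CylSubcritical p) :
    signChoiceAll κ G Φ hg t ht h0 p hp0 hp1 hC = signChoice₂ κ G Φ hg t ht h1 h0 p hp0 hp1 hC := rfl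

/-- **Well-formedness of the multi-type choice function** (`WFS2` of the schedule and `K₀ ≤ K`, exactly as `wfHoldsFn_signChoice₂`). [this work] -/
theorem wfHoldsFnAll_signChoiceAll : WFHoldsFnAll signChoiceAll := by
  intro κ V _ _ G _ Φ hg t ht h0 p hp0 hp1 hC O q _
  exact ⟨Skelφ.Prm.sched_WFS2 _ _, BoxProdZ2.le_Kof κ.K₀⟩

end PlanarSkeletonSign

end Summit.CriticalPhenomena.PercolationContinuityZ3.Theorems.Transplant

end
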